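import Mathlib
import HarnessLib

/-!
# Schwarz reflection for harmonic polynomials across the plane `x₀ + x₁ + x₂ = 0`
# (crux ⟨stmt-QuantumFields-23035⟩ `F4SubCurvatureDoor.ShortRootRigidity`, stub :146 `stub_oddModeRigidity`; step (2) of §1 of the owner's
# paper proof `Cruxes/ShortRootRigidity/TrigonalInjectivity.md`, ym-idea-3 g21, v4 4286f2b0abba282d)

THEOREM (`eval_reflect_eq_neg`): a polynomial `u ∈ ℝ[x₀,x₁,x₂]` with `Δu = 0` (pderiv Laplacian `laplacian3`) which vanishes on the plane
`x₀ + x₁ + x₂ = 0` is ODD under the reflection `σ₁ : x ↦ x − (2/3)(x₀+x₁+x₂)(1,1,1)` in that plane: `u(σ₁ x) = −u(x)`.  In §1 this turns the trace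
identity `Y|_{Π_d} = a E_d|_{Π_d}` into the reflection relation `(R_d)  Y + Y∘σ_d = 2aE_d` (apply the theorem to `u = Y − aE_d`, using `E_d∘σ_d = E_d`).

PROOF (rational coordinates, no analysis).  In the coordinates `X = N x = (x₀+x₁+x₂, x₀−x₁, x₁−x₂)` — inverse `x = M X`, `M = (1/3)·[[1,2,1],[1,−1,1],
[1,−1,−2]]` — the reflection is `X₀ ↦ −X₀` (`reflect_eq`) and the Laplacian is `L = 3∂₀² + 2∂₁² + 2∂₂² − ∂₁∂₂ − ∂₂∂₁` (`lap'_bind₁_κ`, from the chain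
rule `pderiv_bind₁_κ` for the linear substitution `bind₁ κ`, proved by `MvPolynomial.induction_on`, and `M·diag-form·Mᵀ = 1` checked by `module`).
For `w = u∘M`: `w(0,·,·) = 0` kills the coefficient slice `X₀^0` (`coeff_bind₁_zero0`), and the coefficient form of `L w = 0`,
`3(a+2)(a+1)c_{a+2,b,c} = −2(b+2)(b+1)c_{a,b+2,c} − 2(c+2)(c+1)c_{a,b,c+2} + 2(b+1)(c+1)c_{a,b+1,c+1}` (`coeff_pderiv`), kills every EVEN power of
`X₀` by induction (`coeff_even_eq_zero`); so `w(−X₀,X₁,X₂) = −w` coefficientwise (`coeff_bind₁_neg0`, `bind₁_neg0_eq_neg`), and transporting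
back gives the claim.

Mathlib only.  HONEST LABEL: a helper lemma toward the algebraic half of :146; `OddModeRigidity`, ⟨23035⟩, ⟨23125⟩, R2d and the Yang–Mills
mass gap remain OPEN; no summit is proved by a line. [folklore; Schwarz reflection principle, polynomial case]
-/

noncomputable section

namespace Summit.QuantumFields.YangMills.Theorems.F4SubCurvatureDoorSchwarzReflection

open MvPolynomial Finsupp

/-- The polynomial Laplacian `Δ = ∂₀² + ∂₁² + ∂₂²` on `ℝ[x₀, x₁, x₂]`. -/
def laplacian3 (P : MvPolynomial (Fin 3) ℝ) : MvPolynomial (Fin 3) ℝ :=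
  ∑ i : Fin 3, pderiv i (pderiv i P)

/-- `M = ∂x/∂X` for the coordinates `X = (x₀+x₁+x₂, x₀−x₁, x₁−x₂)`: `x₀ = (X₀+2X₁+X₂)/3`, `x₁ = (X₀−X₁+X₂)/3`, `x₂ = (X₀−X₁−2X₂)/3`. -/
def M : Fin 3 → Fin 3 → ℝ :=
  ![![1 / 3, 2 / 3, 1 / 3], ![1 / 3, -1 / 3, 1 / 3], ![1 / 3, -1 / 3, -2 / 3]]

/-- The substitution `x_i ↦ Σ_a M i a · X_a` (a family of linear polynomials). -/
def κ (i : Fin 3) : MvPolynomial (Fin 3) ℝ := ∑ a : Fin 3, C (M i a) * X a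

/-- `y ↦ M y` on points. -/
def Mvec (y : Fin 3 → ℝ) : Fin 3 → ℝ := fun i => ∑ a : Fin 3, M i a * y a

/-- `x ↦ N x = (x₀+x₁+x₂, x₀−x₁, x₁−x₂)` (the inverse of `M`). -/
def Nvec (x : Fin 3 → ℝ) : Fin 3 → ℝ := ![x 0 + x 1 + x 2, x 0 - x 1, x 1 - x 2]

/-- The reflection in the new coordinates: `X₀ ↦ −X₀`. -/
def flip0 (y : Fin 3 → ℝ) : Fin 3 → ℝ := fun i => if i = 0 then -y i else y i

/-- `M (N x) = x`. -/
theorem Mvec_Nvec (x : Fin 3 → ℝ) : Mvec (Nvec x) = x := by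
  funext i
  fin_cases i <;> simp [Mvec, Nvec, M, Fin.sum_univ_three] <;> ring

/-- `σ₁ x = M (flip0 (N x))`: the reflection in `(1,1,1)^⊥` is `X₀ ↦ −X₀` in the new coordinates. -/
theorem reflect_eq (x : Fin 3 → ℝ) :
    (fun i => x i - 2 / 3 * (x 0 + x 1 + x 2)) = Mvec (flip0 (Nvec x)) := by
  funext i
  fin_cases i <;> simp [Mvec, Nvec, flip0, M, Fin.sum_univ_three] <;> ring

/-- The first new coordinate of `M y` is `y₀`. -/
theorem sum_Mvec (y : Fin 3 → ℝ) : Mvec y 0 + Mvec y 1 + Mvec y 2 = y 0 := by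
  simp [Mvec, M, Fin.sum_univ_three]; ring

/-- Evaluation of a substitution (`eval₂Hom_bind₁` at the identity). -/
theorem eval_bind₁' (f : Fin 3 → MvPolynomial (Fin 3) ℝ) (u : MvPolynomial (Fin 3) ℝ) (y : Fin 3 → ℝ) :
    eval y (bind₁ f u) = eval (fun i => eval y (f i)) u :=
  MvPolynomial.eval₂Hom_bind₁ _ _ _ _

/-- `(u∘κ)(y) = u(M y)`. -/
theorem eval_bind₁_κ (u : MvPolynomial (Fin 3) ℝ) (y : Fin 3 → ℝ) : eval y (bind₁ κ u) = eval (Mvec y) u := by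
  have h : (fun i => eval y (κ i)) = Mvec y := by
    funext i
    simp [κ, Mvec, Fin.sum_univ_three]
  rw [eval_bind₁', h]

/-- `∂_a κ_n = M n a`. -/
theorem pderiv_κ (a n : Fin 3) : pderiv a (κ n) = C (M n a) := by
  simp only [κ, Fin.sum_univ_three]
  fin_cases a <;> simp [pderiv_X]

/-- **Chain rule** for the linear substitution: `∂_a (u∘κ) = Σ_i M i a · (∂_i u)∘κ`. -/
theorem pderiv_bind₁_κ (a : Fin 3) (u : MvPolynomial (Fin 3) ℝ) :
    pderiv a (bind₁ κ u) = ∑ i : Fin 3, C (M i a) * bind₁ κ (pderiv i u) := by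
  induction u using MvPolynomial.induction_on with
  | C c => simp
  | add p q hp hq => simp only [map_add, hp, hq, mul_add, Finset.sum_add_distrib]
  | mul_X p n hp =>
    rw [map_mul, bind₁_X_right, Derivation.leibniz, pderiv_κ, hp]
    simp only [Derivation.leibniz, map_add, map_mul, bind₁_X_right, smul_eq_mul, Fin.sum_univ_three]
    fin_cases n <;> simp [pderiv_X] <;> ring

/-- Second-order chain rule. -/
theorem pderiv_pderiv_bind₁_κ (a a' : Fin 3) (u : MvPolynomial (Fin 3) ℝ) :
    pderiv a (pderiv a' (bind₁ κ u)) = ∑ i : Fin 3, ∑ i' : Fin 3, C (M i a') * (C (M i' a) * bind₁ κ (pderiv i' (pderiv i u))) := by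
  rw [pderiv_bind₁_κ, map_sum]
  refine Finset.sum_congr rfl fun i _ => ?_
  rw [pderiv_C_mul, pderiv_bind₁_κ, Finset.mul_sum]

/-- The Laplacian in the new coordinates: `L = 3∂₀² + 2∂₁² + 2∂₂² − ∂₁∂₂ − ∂₂∂₁`. -/
def lap' (w : MvPolynomial (Fin 3) ℝ) : MvPolynomial (Fin 3) ℝ :=
  C 3 * pderiv 0 (pderiv 0 w) + C 2 * pderiv 1 (pderiv 1 w) + C 2 * pderiv 2 (pderiv 2 w)
    - pderiv 1 (pderiv 2 w) - pderiv 2 (pderiv 1 w)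

/-- **Transport of the Laplacian**: `L (u∘κ) = (Δu)∘κ` (`M·Q·Mᵀ = 1` for `Q = [[3,0,0],[0,2,−1],[0,−1,2]]`). -/
theorem lap'_bind₁_κ (u : MvPolynomial (Fin 3) ℝ) : lap' (bind₁ κ u) = bind₁ κ (laplacian3 u) := by
  simp only [lap', laplacian3, pderiv_pderiv_bind₁_κ, Fin.sum_univ_three]
  simp only [M, Matrix.cons_val_zero, Matrix.cons_val_one, Matrix.head_cons, Matrix.cons_val_two, Matrix.tail_cons,
    MvPolynomial.C_mul', smul_smul]
  norm_num
  module


/-! ## Coefficients -/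

/-- The exponent `(a, b, c)`. -/
def fs (a b c : ℕ) : Fin 3 →₀ ℕ := single 0 a + single 1 b + single 2 c

/-- `fs a b c 0 = a`. -/
@[simp] theorem fs_zero (a b c : ℕ) : fs a b c 0 = a := by simp [fs]
/-- `fs a b c 1 = b`. -/
@[simp] theorem fs_one (a b c : ℕ) : fs a b c 1 = b := by simp [fs]
/-- `fs a b c 2 = c`. -/
@[simp] theorem fs_two (a b c : ℕ) : fs a b c 2 = c := by simp [fs]

/-- Every exponent is an `fs`. -/
theorem eq_fs (α : Fin 3 →₀ ℕ) : α = fs (α 0) (α 1) (α 2) := by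
  ext i; fin_cases i <;> simp

/-- Adding a unit exponent. -/
theorem fs_add_single (a b c : ℕ) (i : Fin 3) :
    fs a b c + single i 1 = fs (a + if i = 0 then 1 else 0) (b + if i = 1 then 1 else 0) (c + if i = 2 then 1 else 0) := by
  ext j; fin_cases i <;> fin_cases j <;> simp [fs]

/-- Coefficient of a second derivative. -/
theorem coeff_pderiv_pderiv (w : MvPolynomial (Fin 3) ℝ) (i j : Fin 3) (α : Fin 3 →₀ ℕ) :
    coeff α (pderiv i (pderiv j w)) =
      coeff (α + single i 1 + single j 1) w * (((α + single i 1 : Fin 3 →₀ ℕ) j + 1 : ℕ) : ℝ) * ((α i + 1 : ℕ) : ℝ) := by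
  rw [coeff_pderiv, coeff_pderiv]
  push_cast
  ring

/-- The substitution `X₀ ↦ 0`. -/
def zero0 (i : Fin 3) : MvPolynomial (Fin 3) ℝ := if i = 0 then 0 else X i

/-- Coefficients of `w(0, X₁, X₂)`: the slice `α₀ = 0` of `w`. -/
theorem coeff_bind₁_zero0 (w : MvPolynomial (Fin 3) ℝ) (α : Fin 3 →₀ ℕ) :
    coeff α (bind₁ zero0 w) = if α 0 = 0 then coeff α w else 0 := by
  induction w using MvPolynomial.induction_on' with
  | add p q hp hq =>
    simp only [map_add, coeff_add, hp, hq]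
    split_ifs <;> ring
  | monomial d r =>
    rw [bind₁_monomial, coeff_monomial]
    by_cases hd : d 0 = 0
    · have hprod : (∏ i ∈ d.support, zero0 i ^ d i) = monomial d (1 : ℝ) := by
        rw [MvPolynomial.monomial_eq, C_1, one_mul, Finsupp.prod]
        refine Finset.prod_congr rfl fun i hi => ?_
        have hi0 : i ≠ 0 := by
          intro h; rw [h, Finsupp.mem_support_iff] at hi; exact hi hd
        simp [zero0, hi0]
      rw [hprod, C_mul_monomial, mul_one, coeff_monomial]
      by_cases hα : d = α
      · subst hα; simp [hd]
      · have : ¬ (α 0 = 0 ∧ d = α) := fun h => hα h.2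
        simp only [hα, ↓reduceIte]
        split_ifs <;> rfl
    · have h0 : (0 : Fin 3) ∈ d.support := Finsupp.mem_support_iff.mpr hd
      have hprod : (∏ i ∈ d.support, zero0 i ^ d i) = 0 := by
        refine Finset.prod_eq_zero h0 ?_
        simp [zero0, hd]
      rw [hprod, mul_zero, coeff_zero]
      by_cases hα : d = α
      · subst hα; simp [hd]
      · simp [hα]

/-- The substitution `X₀ ↦ −X₀`. -/
def neg0 (i : Fin 3) : MvPolynomial (Fin 3) ℝ := if i = 0 then -X i else X i

/-- Coefficients of `w(−X₀, X₁, X₂)`. -/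
theorem coeff_bind₁_neg0 (w : MvPolynomial (Fin 3) ℝ) (α : Fin 3 →₀ ℕ) :
    coeff α (bind₁ neg0 w) = (-1) ^ (α 0) * coeff α w := by
  induction w using MvPolynomial.induction_on' with
  | add p q hp hq => simp only [map_add, coeff_add, hp, hq, mul_add]
  | monomial d r =>
    rw [bind₁_monomial]
    have hprod : (∏ i ∈ d.support, neg0 i ^ d i) = C ((-1 : ℝ) ^ (d 0)) * monomial d (1 : ℝ) := by
      rw [MvPolynomial.monomial_eq, C_1, one_mul, Finsupp.prod]
      have hC : (C ((-1 : ℝ) ^ d 0) : MvPolynomial (Fin 3) ℝ) =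
          ∏ i ∈ d.support, (if i = 0 then (C (-1 : ℝ) : MvPolynomial (Fin 3) ℝ) ^ d i else 1) := by
        rw [Finset.prod_ite_eq']
        split_ifs with h
        · rw [map_pow]
        · rw [Finsupp.mem_support_iff, not_not] at h
          rw [h, pow_zero, C_1]
      rw [hC, ← Finset.prod_mul_distrib]
      refine Finset.prod_congr rfl fun i _ => ?_
      by_cases hi : i = 0
      · subst hi
        simp only [neg0, ↓reduceIte]
        rw [← mul_pow, neg_eq_neg_one_mul, map_neg, C_1]
      · simp [neg0, hi]
    rw [hprod, ← mul_assoc, ← map_mul, C_mul_monomial, mul_one, coeff_monomial, coeff_monomial]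
    by_cases hα : d = α
    · subst hα; simp [mul_comm]
    · simp [hα]

/-! ## Parity -/

/-- **Core parity lemma**: `L w = 0` and `w(0,·,·) = 0` force every coefficient with EVEN `X₀`-exponent to vanish. -/
theorem coeff_even_eq_zero (w : MvPolynomial (Fin 3) ℝ) (hL : lap' w = 0) (h0 : ∀ y : Fin 3 → ℝ, y 0 = 0 → eval y w = 0)
    (m b c : ℕ) : coeff (fs (2 * m) b c) w = 0 := by
  have hslice : bind₁ zero0 w = 0 := by
    refine MvPolynomial.funext fun y => ?_
    rw [map_zero, eval_bind₁']
    refine h0 _ ?_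
    simp [zero0]
  have hbase : ∀ b c : ℕ, coeff (fs 0 b c) w = 0 := by
    intro b c
    have h := coeff_bind₁_zero0 w (fs 0 b c)
    rw [hslice, coeff_zero] at h
    simpa using h.symm
  have hrec : ∀ a b c : ℕ, (3 * (((a : ℝ) + 2) * (a + 1))) * coeff (fs (a + 2) b c) w =
      -(2 * (((b : ℝ) + 2) * (b + 1)) * coeff (fs a (b + 2) c) w + 2 * (((c : ℝ) + 2) * (c + 1)) * coeff (fs a b (c + 2)) w
        - 2 * (((b : ℝ) + 1) * (c + 1)) * coeff (fs a (b + 1) (c + 1)) w) := by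
    intro a b c
    have h := congrArg (coeff (fs a b c)) hL
    rw [coeff_zero, lap'] at h
    simp only [coeff_sub, coeff_add, coeff_C_mul, coeff_pderiv_pderiv, fs_add_single] at h
    simp only [Fin.isValue, ↓reduceIte, add_zero, fs_zero, fs_one, fs_two,
      show ((2 : Fin 3) = 0) = False by decide, show ((1 : Fin 3) = 0) = False by decide,
      show ((0 : Fin 3) = 1) = False by decide, show ((2 : Fin 3) = 1) = False by decide,
      show ((0 : Fin 3) = 2) = False by decide, show ((1 : Fin 3) = 2) = False by decide] at h
    push_cast at h
    linear_combination h
  induction m generalizing b c with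
  | zero => simpa using hbase b c
  | succ m ih =>
    have h := hrec (2 * m) b c
    rw [ih (b + 2) c, ih b (c + 2), ih (b + 1) (c + 1)] at h
    have hne : (3 * ((((2 * m : ℕ) : ℝ) + 2) * (((2 * m : ℕ) : ℝ) + 1))) ≠ 0 := by positivity
    rw [show 2 * (m + 1) = 2 * m + 2 by ring]
    have h' : (3 * ((((2 * m : ℕ) : ℝ) + 2) * (((2 * m : ℕ) : ℝ) + 1))) * coeff (fs (2 * m + 2) b c) w = 0 := by
      linarith
    exact (mul_eq_zero.mp h').resolve_left hne

/-- Hence `w(−X₀, X₁, X₂) = −w` as polynomials. -/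
theorem bind₁_neg0_eq_neg (w : MvPolynomial (Fin 3) ℝ) (hL : lap' w = 0) (h0 : ∀ y : Fin 3 → ℝ, y 0 = 0 → eval y w = 0) :
    bind₁ neg0 w = -w := by
  refine MvPolynomial.ext _ _ fun α => ?_
  rw [coeff_bind₁_neg0, coeff_neg]
  rcases Nat.even_or_odd (α 0) with ⟨m, hm⟩ | hodd
  · have hz : coeff α w = 0 := by
      rw [eq_fs α, hm, ← two_mul]
      exact coeff_even_eq_zero w hL h0 m (α 1) (α 2)
    rw [hz, mul_zero, neg_zero]
  · rw [hodd.neg_one_pow]; ring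

/-- … and pointwise. -/
theorem eval_flip0 (w : MvPolynomial (Fin 3) ℝ) (hL : lap' w = 0) (h0 : ∀ y : Fin 3 → ℝ, y 0 = 0 → eval y w = 0)
    (y : Fin 3 → ℝ) : eval (flip0 y) w = -eval y w := by
  have h1 : eval y (bind₁ neg0 w) = eval (flip0 y) w := by
    have hf : (fun i => eval y (neg0 i)) = flip0 y := by
      funext i
      by_cases hi : i = 0 <;> simp [flip0, neg0, hi]
    rw [eval_bind₁', hf]
  rw [← h1, bind₁_neg0_eq_neg w hL h0, map_neg]

/-! ## Schwarz reflection -/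

/-- **SCHWARZ REFLECTION (polynomial form).**  A harmonic polynomial on `ℝ³` vanishing on the plane `x₀ + x₁ + x₂ = 0` is odd under the
reflection `x ↦ x − (2/3)(x₀+x₁+x₂)(1,1,1)` in that plane. [folklore] -/
theorem eval_reflect_eq_neg (u : MvPolynomial (Fin 3) ℝ) (hharm : laplacian3 u = 0)
    (hvan : ∀ x : Fin 3 → ℝ, x 0 + x 1 + x 2 = 0 → eval x u = 0) (x : Fin 3 → ℝ) :
    eval (fun i => x i - 2 / 3 * (x 0 + x 1 + x 2)) u = -eval x u := by
  set w := bind₁ κ u with hw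
  have hL : lap' w = 0 := by rw [hw, lap'_bind₁_κ, hharm, map_zero]
  have h0 : ∀ y : Fin 3 → ℝ, y 0 = 0 → eval y w = 0 := by
    intro y hy
    rw [hw, eval_bind₁_κ]
    exact hvan _ (by rw [sum_Mvec, hy])
  rw [reflect_eq, ← eval_bind₁_κ, ← hw, eval_flip0 w hL h0, hw, eval_bind₁_κ, Mvec_Nvec]

end Summit.QuantumFields.YangMills.Theorems.F4SubCurvatureDoorSchwarzReflection

end
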